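import Mathlib
import Summits.ValiantsHypothesis.ValiantsHypothesis.Theorems.ValuativeGCTValuativeFlipTwoRowSeeds

/-!
# Explicit two-row highest-weight vectors, V: multiplicity lower bounds for the padded permanent at
# two-row weights (crux `ValuativeGCT.ValuativeFlip`, stmt-ValiantsHypothesis-12624; wall-breaker axis k13)

Consequences of the explicit seeds (parts A–E) for the per-side MULTIPLICITIES
`orbitMultiplicity ℂ (paddedPerFormLex ℂ n m) m χ = dim HWV_χ ℂ[Δ_m(X₀₀^{m-n} per_n)]`, uniformly in `m ≥ n`:

* `card_monomials_le_orbitMultiplicity_paddedPer` — **two-row multiplicities dominate restricted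
  partition counts**: monomials `∏_j [F_j]^{e_j}` (`j ∈ {0, 2, …, n-1}`) in the algebraically independent
  seed classes are linearly independent highest-weight vectors, so for any finite set `S` of exponent
  vectors of one common weight `χ`, `|S| ≤ mult_χ`.  The weight of `∏ [F_j]^{e_j}` is
  `(-w, -(D·m - w))` on the last two letters with `w = ∑ j e_j` (isobaric weight) and `D = ∑ (j+1) e_j`
  (degree) (`sum_smul_twoRowWeight_eq`), i.e. the dual of the two-row partition `(D m - w, w)`; hence
  `mult_{(Dm-w, w)^*} ℂ[Δ_m(X₀₀^{m-n} per_n)] ≥ #{partitions of w into parts from {2, …, n-1} with at most D - w parts}`.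
* `seedWeight_eq_partitionWeightLex`, `choose_le_orbitMultiplicity_paddedPer_seedPartition` — the ray
  bound of part E in the crux's currency of partition weights
  `(Weight.dualOfPartition (m*m) λ).toMatIdx`: `C(k + n - 3, n - 3) ≤ mult_{k • λ*}` for the two-row
  `λ = ((L/2) m + L (m-1), L)`, `L = (n-1)!`.

(Two-row shapes are determinant-dominated — every binary form is a determinant of a diagonal pencil —
so these bounds are per-side information, not flips; see AXIS.md of the seat.)  Sources: folklore.
-/

set_option linter.dupNamespace false

namespace Summit.ValiantsHypothesis.ValiantsHypothesis.Theorems.ValuativeFlip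

open MvPolynomial
open scoped BigOperators

noncomputable section

section Multiplicity

open Literature.NumberTheory.DiophantineGeometry Literature.Computability.AlgebraicComplexity
  Literature.Barriers.ValiantsHypothesis Literature.Computability.Complexity

variable {n m : ℕ}

/-! ### Monomials in the seed classes -/

/-- Products of powers of highest-weight vectors are highest-weight vectors, weights adding.
[folklore] -/
theorem prod_pow_mem_highestWeightSpace_orbitCoordRep {σ : Type*} [Fintype σ] [LinearOrder σ]
    (f : MvPolynomial σ ℂ) (m : ℕ) {ι : Type*} (s : Finset ι) (x : ι → OrbitCoordRing f m)
    (χ : ι → Weight σ) (hx : ∀ i ∈ s, x i ∈ highestWeightSpace (orbitCoordRep f m) (χ i)) (k : ι → ℕ) :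
    ∏ i ∈ s, x i ^ k i ∈ highestWeightSpace (orbitCoordRep f m) (∑ i ∈ s, k i • χ i) := by
  classical
  induction s using Finset.induction_on with
  | empty =>
    rw [Finset.prod_empty, Finset.sum_empty]
    have h := pow_mem_highestWeightSpace_orbitCoordRep f m (χ := 0) (x := 1)
      (by intro g _; rw [orbitCoordRep_apply, map_one]; simp [weightChar]) 0
    rwa [pow_zero, zero_smul] at h
  | insert a s ha ih =>
    rw [Finset.prod_insert ha, Finset.sum_insert ha]
    exact mul_mem_highestWeightSpace_orbitCoordRep f m
      (pow_mem_highestWeightSpace_orbitCoordRep f m (hx a (Finset.mem_insert_self a s)) (k a))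
      (ih fun i hi => hx i (Finset.mem_insert_of_mem hi))

/-- **The weight of a monomial in the seed classes**: `∑_i e_i · wt(F_{seedIdx i})` is `-w` on the letter
`(m-1, m-2)` and `-(∑_i e_i (m + seedIdx i · (m-1)))` on `(m-1, m-1)` (`w = ∑_i e_i · seedIdx i` the
isobaric weight; the second entry is `D m - w` with `D = ∑_i e_i (seedIdx i + 1)` the degree), zero
elsewhere. [folklore] -/
theorem sum_smul_twoRowWeight_eq (hm : 2 ≤ m) (e : Fin (n - 1) →₀ ℕ) :
    (e.sum fun i k => k • twoRowWeight m hm (seedIdx i)) =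
      Function.extend (lastTwo hm)
        (fun a : Fin 2 => if a = 0 then -((e.sum fun i k => k * seedIdx i : ℕ) : ℤ)
          else -((e.sum fun i k => k * (m + seedIdx i * (m - 1)) : ℕ) : ℤ)) 0 := by
  funext y
  simp only [Finsupp.sum, Finset.sum_apply, Pi.smul_apply, twoRowWeight]
  by_cases hy : y ∈ Set.range (lastTwo hm)
  · obtain ⟨a, rfl⟩ := hy
    simp only [(lastTwo_strictMono hm).injective.extend_apply, protoWeight]
    fin_cases a
    · simp only [Fin.zero_eta, Fin.isValue, if_true, smul_neg, nsmul_eq_mul, Finset.sum_neg_distrib,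
        Nat.cast_sum, Nat.cast_mul]
    · simp only [Fin.mk_one, Fin.isValue, one_ne_zero, if_false, smul_neg, nsmul_eq_mul,
        Finset.sum_neg_distrib, Nat.cast_sum, Nat.cast_mul, Nat.cast_add]
  · have h0 : ∀ w : Weight (Fin 2), Function.extend (lastTwo hm) w 0 y = 0 := fun w => by
      rw [Function.extend_apply' _ _ _ (fun ⟨a, ha⟩ => hy ⟨a, ha⟩), Pi.zero_apply]
    simp only [h0, smul_zero, Finset.sum_const_zero]

/-- **Two-row multiplicities of the padded permanent dominate monomial counts** (`3 ≤ n ≤ m`): for any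
finite set `S` of exponent vectors on the seed classes `[F_0], [F_2], …, [F_{n-1}]` whose monomials
have one common weight `χ`, `|S| ≤ orbitMultiplicity ℂ (paddedPerFormLex ℂ n m) m χ` (the monomials are
linearly independent — images of distinct monomials under the injective `aeval` of the algebraically
independent seed classes — highest-weight vectors of weight `χ`, and the highest-weight space is
finite-dimensional, BLMW 2011 §5.2). [folklore] -/
theorem card_monomials_le_orbitMultiplicity_paddedPer {n m : ℕ} [NeZero n] [NeZero m] (hn : 3 ≤ n)
    (hnm : n ≤ m) (hm : 2 ≤ m) (S : Finset (Fin (n - 1) →₀ ℕ)) (χ : Weight (MatIdx m))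
    (hS : ∀ e ∈ S, (e.sum fun i k => k • twoRowWeight m hm (seedIdx i)) = χ) :
    S.card ≤ orbitMultiplicity ℂ (paddedPerFormLex ℂ n m) m χ := by
  classical
  set x : Fin (n - 1) → OrbitCoordRing (paddedPerFormLex ℂ n m) m := fun i =>
    Ideal.Quotient.mk (orbitVanishingIdeal (paddedPerFormLex ℂ n m) m) (twoRowHWV m hm (seedIdx i)) with hxdef
  have hind : AlgebraicIndependent ℂ x := algebraicIndependent_mk_twoRowHWV hn hnm hm
  set W := highestWeightSpace (orbitCoordRep (paddedPerFormLex ℂ n m) m) χ with hW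
  haveI : FiniteDimensional ℂ W :=
    finiteDimensional_highestWeightSpace_orbitCoordRep_holds (k := ℂ) (paddedPerFormLex ℂ n m) (NeZero.ne m) χ
  -- the monomials, as elements of `W`
  have hmem : ∀ e ∈ S, aeval x (monomial e (1 : ℂ)) ∈ W := by
    intro e he
    rw [aeval_monomial, map_one, one_mul, Finsupp.prod_fintype _ _ (fun i => pow_zero (x i)), hW, ← hS e he,
      Finsupp.sum_fintype e (fun i k => k • twoRowWeight m hm (seedIdx i)) (fun i => zero_smul ℕ _)]
    exact prod_pow_mem_highestWeightSpace_orbitCoordRep _ m Finset.univ x (fun i => twoRowWeight m hm (seedIdx i))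
      (fun i _ => mk_twoRowHWV_mem_highestWeightSpace hm
        (by have := seedIdx_le i; have := i.2; omega) n) e
  set v : S → W := fun e => ⟨aeval x (monomial e.1 (1 : ℂ)), hmem e.1 e.2⟩ with hv
  have hli : LinearIndependent ℂ v := by
    have hamb : LinearIndependent ℂ fun e : S => aeval x (monomial e.1 (1 : ℂ)) := by
      have hmon : LinearIndependent ℂ fun e : (Fin (n - 1) →₀ ℕ) => (monomial e (1 : ℂ) :
          MvPolynomial (Fin (n - 1)) ℂ) := by
        have h := (basisMonomials (Fin (n - 1)) ℂ).linearIndependent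
        rwa [coe_basisMonomials] at h
      have hmap := hmon.map' (aeval x).toLinearMap (LinearMap.ker_eq_bot.mpr hind)
      exact hmap.comp (fun e : S => e.1) Subtype.val_injective
    exact LinearIndependent.of_comp W.subtype hamb
  have hcard := hli.fintype_card_le_finrank
  rw [Fintype.card_coe] at hcard
  exact hcard

/-! ### The seed weight in the crux's currency: the dual weight of a two-row partition -/

/-- The rows of the seed partition: `λ₁ = (L/2)·m + L·(m-1)`, `λ₂ = L`, no further rows. [folklore] -/
def seedRows (n m : ℕ) : ℕ → ℕ :=
  fun r => if r = 0 then seedL n / 2 * m + seedL n * (m - 1) else if r = 1 then seedL n else 0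

/-- The seed rows are weakly decreasing (`2 ≤ m`). [folklore] -/
theorem seedRows_antitone (hm : 2 ≤ m) : Antitone (seedRows n m) := by
  intro a b hab
  simp only [seedRows]
  have hL : seedL n ≤ seedL n * (m - 1) := Nat.le_mul_of_pos_right _ (by omega)
  split_ifs <;> omega

/-- The seed rows sum to `m · (L/2 + L)` (`1 ≤ m`). [folklore] -/
theorem sum_seedRows (hm : 1 ≤ m) : ∑ r ∈ Finset.range 2, seedRows n m r = m * (seedL n / 2 + seedL n) := by
  rw [Finset.sum_range_succ, Finset.sum_range_one]
  simp only [seedRows, if_true, one_ne_zero, if_false]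
  have : seedL n * (m - 1) + seedL n = seedL n * m := by
    conv_rhs => rw [← Nat.sub_add_cancel hm, mul_add, mul_one]
  rw [add_assoc, this]
  ring

/-- **The seed partition** `λ = ((L/2)·m + L·(m-1), L) ⊢ m · (3L/2)` of the common weight of the
seeds (`seedWeight n m = λ*`, `seedWeight_eq_partitionWeightLex`). [folklore] -/
def seedPartition (n m : ℕ) [NeZero m] : Nat.Partition (m * (seedL n / 2 + seedL n)) :=
  partitionOfRows (seedRows n m) 2 (m * (seedL n / 2 + seedL n))

/-- The positions of the last two letters in the enumeration `matIdxEquiv m`: `m² - 2 + a`.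
[folklore] -/
theorem matIdxEquiv_symm_lastTwo_val (hm : 2 ≤ m) (a : Fin 2) :
    (((matIdxEquiv m).symm (lastTwo hm a) : Fin (m * m)) : ℕ) = m * m - 2 + a := by
  rw [lastTwo, matIdxEquiv_symm_lastRow_val]
  have ha := a.2
  have h1 : m * (m - 1) + m = m * m := by
    obtain ⟨k, rfl⟩ : ∃ k, m = k + 1 := ⟨m - 1, by omega⟩
    rw [Nat.add_sub_cancel]
    ring
  simp only
  omega

/-- **`seedWeight n m` is the dual weight `λ*` of the seed partition**, i.e.
`(Weight.dualOfPartition (m*m) (seedPartition n m)).toMatIdx` — the form in which the crux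
`ValuativeFlip` and `orbitMultiplicity` statements of the route quote weights. [folklore] -/
theorem seedWeight_eq_partitionWeightLex [NeZero m] (hm : 2 ≤ m) :
    seedWeight n m hm = partitionWeightLex m (seedPartition n m) := by
  have hsum : ∑ r ∈ Finset.range 2, seedRows n m r = m * (seedL n / 2 + seedL n) := sum_seedRows (by omega)
  funext y
  rw [partitionWeightLex, Weight.toMatIdx, Weight.dualOfPartition, Weight.dual, Weight.ofPartition,
    Fin.val_rev, seedPartition, getD_sortedParts_partitionOfRows (seedRows_antitone hm) hsum, seedWeight]
  have hmm : 2 ≤ m * m := by nlinarith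
  by_cases hy : y ∈ Set.range (lastTwo hm)
  · obtain ⟨a, rfl⟩ := hy
    rw [(lastTwo_strictMono hm).injective.extend_apply, matIdxEquiv_symm_lastTwo_val hm]
    fin_cases a
    · simp only [seedWeight₂, seedRows, Fin.zero_eta, Fin.isValue, if_true, add_zero]
      rw [show m * m - (m * m - 2 + 1) = 1 by omega]
      simp
    · simp only [seedWeight₂, seedRows, Fin.mk_one, Fin.isValue, one_ne_zero, if_false]
      rw [show m * m - (m * m - 2 + 1 + 1) = 0 by omega]
      simp
  · rw [Function.extend_apply' _ _ _ (fun ⟨a, ha⟩ => hy ⟨a, ha⟩), Pi.zero_apply]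
    -- `y` sits below the last two letters: its position is `≤ m² - 3`
    have hpos : (((matIdxEquiv m).symm y : Fin (m * m)) : ℕ) + 2 < m * m := by
      have hlt := ((matIdxEquiv m).symm y).2
      have hne : ∀ a : Fin 2, (((matIdxEquiv m).symm y : Fin (m * m)) : ℕ) ≠ m * m - 2 + a := by
        intro a ha
        apply hy
        refine ⟨a, (matIdxEquiv m).symm.injective (Fin.ext ?_)⟩
        rw [matIdxEquiv_symm_lastTwo_val hm, ← ha]
      have h0 := hne 0
      have h1 := hne 1
      simp only [Fin.isValue, Fin.val_zero, add_zero, Fin.val_one] at h0 h1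
      omega
    rw [if_neg (by omega)]
    simp

/-- **The explicit per-side multiplicity lower bound, stated with partition weights**: for
`3 ≤ n ≤ m` and every `k`, `C(k + n - 3, n - 3) ≤ mult_{k • λ*} ℂ[Δ_m(X₀₀^{m-n} per_n)]` for the
two-row seed partition `λ = seedPartition n m`. [folklore] -/
theorem choose_le_orbitMultiplicity_paddedPer_seedPartition [NeZero n] [NeZero m] (hn : 3 ≤ n)
    (hnm : n ≤ m) (hm : 2 ≤ m) (k : ℕ) :
    (k + (n - 3)).choose (n - 3) ≤
      orbitMultiplicity ℂ (paddedPerFormLex ℂ n m) m (k • partitionWeightLex m (seedPartition n m)) := by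
  rw [← seedWeight_eq_partitionWeightLex hm]
  exact choose_le_orbitMultiplicity_paddedPer_twoRow_ray hn hnm hm k


end Multiplicity

end

end Summit.ValiantsHypothesis.ValiantsHypothesis.Theorems.ValuativeFlip
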